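import Mathlib
import Literature.Analysis.ODE.RecursiveSeries
import Literature.NumberTheory.LFunctions.RieszMeanInvDedekindZeta
import Literature.NumberTheory.LFunctions.DegreeOnePrimes
import Literature.NumberTheory.LFunctions.DegreeOnePrimesPNT
import Literature.NumberTheory.LFunctions.HallTenenbaumTheorem01
import Literature.NumberTheory.LFunctions.DedekindZetaVonMangoldt
import Literature.NumberTheory.LFunctions.SiegelWalfiszMoebius
import Literature.NumberTheory.LFunctions.MoebiusLogHarmonicSum
import Literature.NumberTheory.LFunctions.RudnickSarnakNExchange
import Literature.NumberTheory.Sieve.BatemanHornProofs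
import Literature.NumberTheory.Sieve.BatemanHornLocalCounts
import Literature.NumberTheory.Sieve.PolynomialCongruencesLemmas
import Literature.NumberTheory.Sieve.PolynomialCongruencesProofs
import Literature.NumberTheory.Sieve.PolynomialCongruencesMeanValues
import Literature.NumberTheory.Sieve.PolynomialValuesSieveSequence
import Literature.NumberTheory.Sieve.SieveFrameworkProofs
import Literature.NumberTheory.Sieve.ShiuTheoremProofs
import Literature.NumberTheory.Sieve.AsymptoticSieveForPrimesHolds
import Literature.NumberTheory.Sieve.FriedlanderIwaniecPrimesSquarefreeProofs
import Literature.NumberTheory.Sieve.DivisorPowerSums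
import Summits.Parity.BatemanHorn.Theorems.IsogenyRedeiDefs
import HarnessLib

/-!
# Type-I main term for Bateman–Horn (stmt-Parity-0873), input B2 (part 1):
# simultaneous polynomial congruences `d_i ∣ f_i(n)` — periodicity and the Chinese remainder theorem

For a system `f : Fin k → ℤ[X]` and a tuple of moduli `d : Fin k → ℕ` let `L = lcm_i d_i`
(`tupleLcm d`) and `ρ(d) = #{n mod L : d_i ∣ f_i(n) for all i}` (`sysCount f d`). We prove

* `sysSols f d s` — the solutions in `s`; `sysPred_mod` — the condition only depends on `n mod L`;
* `card_filter_Ico_sysPred` — every block of `L` consecutive integers contains exactly `ρ(d)`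
  solutions; `abs_card_filter_Icc_sysPred_sub_le` — `|#{n ∈ [a, b] : …} − ((b+1−a)/L) ρ(d)| ≤ ρ(d)`;
* `card_filter_range_mul_of_periodic` — CRT for counts: for coprime periods `L, L'` and
  periodic predicates `A, B`, `#{n < LL' : A n ∧ B n} = #{n < L : A n} · #{n < L' : B n}`;
* `tupleLcm_mul`, `sysCount_mul` — for tuples `d, d'` with `(∏ d_i, ∏ d'_i) = 1`:
  `lcm(dd') = lcm(d) lcm(d')` and `ρ(dd') = ρ(d) ρ(d')`.

Everything here is proved. [folklore]
-/

noncomputable section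

open Finset Polynomial

namespace Summit.Parity.BatemanHorn.Theorems.TypeIMainTerm

variable {k : ℕ}

/-- `d i ∣ tupleLcm d`. -/
theorem dvd_tupleLcm (d : Fin k → ℕ) (i : Fin k) : d i ∣ tupleLcm d :=
  Finset.dvd_lcm (Finset.mem_univ i)

/-- `tupleLcm d ∣ ∏ i, d i`. -/
theorem tupleLcm_dvd_prod (d : Fin k → ℕ) : tupleLcm d ∣ ∏ i, d i :=
  Finset.lcm_dvd fun i _ => Finset.dvd_prod_of_mem d (Finset.mem_univ i)

/-- `0 < tupleLcm d`. -/
theorem tupleLcm_pos {d : Fin k → ℕ} (hd : ∀ i, 0 < d i) : 0 < tupleLcm d := by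
  refine Nat.pos_of_ne_zero fun h => ?_
  rw [tupleLcm, Finset.lcm_eq_zero_iff] at h
  obtain ⟨i, -, hi⟩ := h
  exact (hd i).ne' hi

open Classical in
/-- Membership in `sysSols`. -/
theorem mem_sysSols {f : Fin k → ℤ[X]} {d : Fin k → ℕ} {s : Finset ℕ} {n : ℕ} :
    n ∈ sysSols f d s ↔ n ∈ s ∧ ∀ i, ((d i : ℕ) : ℤ) ∣ (f i).eval (n : ℤ) := by
  classical
  unfold sysSols
  rw [Finset.mem_filter]

/-- `sysSols f d s ⊆ s`. -/
theorem sysSols_subset (f : Fin k → ℤ[X]) (d : Fin k → ℕ) (s : Finset ℕ) : sysSols f d s ⊆ s :=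
  fun _ hn => (mem_sysSols.mp hn).1

/-- `sysSols f d s ⊆ sysSols f d t`. -/
theorem sysSols_mono (f : Fin k → ℤ[X]) (d : Fin k → ℕ) {s t : Finset ℕ} (h : s ⊆ t) :
    sysSols f d s ⊆ sysSols f d t :=
  fun _ hn => mem_sysSols.mpr ⟨h (mem_sysSols.mp hn).1, (mem_sysSols.mp hn).2⟩

/-- `sysSols f d (s ∪ t) = sysSols f d s ∪ sysSols f d t`. -/
theorem sysSols_union (f : Fin k → ℤ[X]) (d : Fin k → ℕ) (s t : Finset ℕ) :
    sysSols f d (s ∪ t) = sysSols f d s ∪ sysSols f d t := by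
  classical
  unfold sysSols; exact Finset.filter_union _ _ _

/-- `sysSols` of `insert a s`: add `a` iff it solves the congruences. -/
theorem sysSols_insert (f : Fin k → ℤ[X]) (d : Fin k → ℕ) (a : ℕ) (s : Finset ℕ) :
    sysSols f d (insert a s) =
      if ∀ i, ((d i : ℕ) : ℤ) ∣ (f i).eval (a : ℤ) then insert a (sysSols f d s) else sysSols f d s := by
  classical
  unfold sysSols; exact Finset.filter_insert _ _ _

/-- The condition is periodic: it only depends on `n mod m` for any common multiple `m` of the `d_i`. -/
theorem sysPred_iff_of_modEq (f : Fin k → ℤ[X]) (d : Fin k → ℕ) {m n n' : ℕ}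
    (hm : ∀ i, d i ∣ m) (h : n ≡ n' [MOD m]) :
    (∀ i, ((d i : ℕ) : ℤ) ∣ (f i).eval (n : ℤ)) ↔ ∀ i, ((d i : ℕ) : ℤ) ∣ (f i).eval (n' : ℤ) := by
  have key : ∀ i, ((d i : ℕ) : ℤ) ∣ (f i).eval (n' : ℤ) - (f i).eval (n : ℤ) := by
    intro i
    have h1 : ((n' : ℤ) - (n : ℤ)) ∣ (f i).eval (n' : ℤ) - (f i).eval (n : ℤ) :=
      Polynomial.sub_dvd_eval_sub _ _ _
    have h2 : ((m : ℕ) : ℤ) ∣ (n' : ℤ) - (n : ℤ) := (Nat.modEq_iff_dvd.mp h)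
    exact ((Int.natCast_dvd_natCast.mpr (hm i)).trans h2).trans h1
  constructor
  · intro hn i
    have := dvd_add (hn i) (key i)
    rwa [add_sub_cancel] at this
  · intro hn i
    have := dvd_sub (hn i) (key i)
    rwa [sub_sub_cancel] at this

/-- The condition at `n` agrees with the condition at `n % L`. -/
theorem sysPred_mod (f : Fin k → ℤ[X]) (d : Fin k → ℕ) (n : ℕ) :
    (∀ i, ((d i : ℕ) : ℤ) ∣ (f i).eval (n : ℤ)) ↔
      ∀ i, ((d i : ℕ) : ℤ) ∣ (f i).eval ((n % tupleLcm d : ℕ) : ℤ) :=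
  sysPred_iff_of_modEq f d (dvd_tupleLcm d) (Nat.mod_modEq n (tupleLcm d)).symm

/-- **Every block of `L` consecutive integers contains exactly `ρ(d)` solutions** (shift the
block by one: the element leaving and the element entering are congruent mod `L`). -/
theorem card_filter_Ico_sysPred (f : Fin k → ℤ[X]) (d : Fin k → ℕ) (a : ℕ) :
    (sysSols f d (Finset.Ico a (a + tupleLcm d))).card = sysCount f d := by
  set L := tupleLcm d with hL
  induction a with
  | zero => rw [zero_add, sysCount, Finset.range_eq_Ico]
  | succ a ih =>
    rcases Nat.eq_zero_or_pos L with hL0 | hL0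
    · have h0 : ∀ b : ℕ, (sysSols f d (Finset.Ico b (b + L))).card = 0 := fun b => by
        rw [hL0, add_zero, Finset.Ico_self]
        exact Finset.card_eq_zero.mpr (Finset.subset_empty.mp (sysSols_subset f d ∅))
      rw [h0] at ih ⊢; exact ih
    rw [← ih]
    have e1 : Finset.Ico a (a + L) = insert a (Finset.Ico (a + 1) (a + L)) :=
      (Finset.insert_Ico_add_one_left_eq_Ico (by omega)).symm
    have e2 : Finset.Ico (a + 1) (a + 1 + L) = insert (a + L) (Finset.Ico (a + 1) (a + L)) := by
      rw [show a + 1 + L = a + L + 1 by ring]; exact Nat.Ico_succ_right_eq_insert_Ico (by omega)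
    have hper := sysPred_iff_of_modEq f d (m := L) (n := a) (n' := a + L) (dvd_tupleLcm d)
      (Nat.add_modEq_right).symm
    rw [e1, e2, sysSols_insert, sysSols_insert]
    by_cases ha : ∀ i, ((d i : ℕ) : ℤ) ∣ (f i).eval (a : ℤ)
    · rw [if_pos ha, if_pos (hper.mp ha), Finset.card_insert_of_notMem, Finset.card_insert_of_notMem]
      · intro h; have := Finset.mem_Ico.mp (sysSols_subset f d _ h); omega
      · intro h; have := Finset.mem_Ico.mp (sysSols_subset f d _ h); omega
    · rw [if_neg ha, if_neg (fun h => ha (hper.mpr h))]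

/-- `q` consecutive blocks contain `q ρ(d)` solutions. -/
theorem card_filter_Ico_mul_sysPred (f : Fin k → ℤ[X]) (d : Fin k → ℕ) (a q : ℕ) :
    (sysSols f d (Finset.Ico a (a + q * tupleLcm d))).card = q * sysCount f d := by
  induction q with
  | zero =>
    rw [zero_mul, add_zero, Finset.Ico_self, zero_mul]
    exact Finset.card_eq_zero.mpr (Finset.subset_empty.mp (sysSols_subset f d ∅))
  | succ q ih =>
    rw [add_mul, one_mul, ← add_assoc, ← Finset.Ico_union_Ico_eq_Ico (Nat.le_add_right _ _)
      (Nat.le_add_right _ _), sysSols_union, Finset.card_union_of_disjoint, ih,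
      card_filter_Ico_sysPred, add_mul, one_mul]
    exact Finset.disjoint_of_subset_left (sysSols_subset f d _)
      (Finset.disjoint_of_subset_right (sysSols_subset f d _) (Finset.Ico_disjoint_Ico_consecutive _ _ _))

/-- **Counting solutions in an interval**: for `L = lcm d ≥ 1`,
`|#{n ∈ [a, a+N) : d_i ∣ f_i(n) ∀ i} − (N/L) ρ(d)| ≤ ρ(d)`. -/
theorem abs_card_filter_Ico_sysPred_sub_le (f : Fin k → ℤ[X]) (d : Fin k → ℕ)
    (hL : 0 < tupleLcm d) (a N : ℕ) :
    |((sysSols f d (Finset.Ico a (a + N))).card : ℝ) -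
        (N : ℝ) / (tupleLcm d : ℝ) * (sysCount f d : ℝ)| ≤ sysCount f d := by
  set L := tupleLcm d with hLdef
  set ρ := sysCount f d with hρ
  set q := N / L with hq
  set r := N % L with hr
  have hN : N = q * L + r := by rw [hq, hr, mul_comm, Nat.div_add_mod]
  have hrL : r < L := Nat.mod_lt N hL
  have hsplit : (sysSols f d (Finset.Ico a (a + N))).card =
      q * ρ + (sysSols f d (Finset.Ico (a + q * L) (a + q * L + r))).card := by
    rw [hN, ← add_assoc, ← Finset.Ico_union_Ico_eq_Ico (Nat.le_add_right _ _)
      (Nat.le_add_right _ _), sysSols_union, Finset.card_union_of_disjoint,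
      card_filter_Ico_mul_sysPred]
    exact Finset.disjoint_of_subset_left (sysSols_subset f d _)
      (Finset.disjoint_of_subset_right (sysSols_subset f d _) (Finset.Ico_disjoint_Ico_consecutive _ _ _))
  have hpart : (sysSols f d (Finset.Ico (a + q * L) (a + q * L + r))).card ≤ ρ := by
    rw [hρ, ← card_filter_Ico_sysPred f d (a + q * L)]
    exact Finset.card_le_card (sysSols_mono f d (Finset.Ico_subset_Ico_right (by omega)))
  rw [hsplit]
  have hL0 : (0 : ℝ) < L := by exact_mod_cast hL
  have e : (N : ℝ) / L * ρ = q * ρ + (r : ℝ) / L * ρ := by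
    rw [hN]; push_cast; field_simp
  rw [e]
  push_cast
  have h1 : (0 : ℝ) ≤ (r : ℝ) / L * ρ := by positivity
  have h2 : (r : ℝ) / L * ρ ≤ ρ := by
    have : (r : ℝ) / L ≤ 1 := by rw [div_le_one hL0]; exact_mod_cast hrL.le
    nlinarith [show (0:ℝ) ≤ ρ from Nat.cast_nonneg _]
  have h3 : ((sysSols f d (Finset.Ico (a + q * L) (a + q * L + r))).card : ℝ) ≤ ρ := by
    exact_mod_cast hpart
  have h4 : (0 : ℝ) ≤ ((sysSols f d (Finset.Ico (a + q * L) (a + q * L + r))).card : ℝ) :=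
    Nat.cast_nonneg _
  rw [abs_le]; constructor <;> linarith

/-! ### The Chinese remainder theorem for counts -/

/-- **CRT for counts.** For coprime positive `L, L'` and predicates `A` (period `L`) and
`B` (period `L'`): `#{n < LL' : A n ∧ B n} = #{n < L : A n} · #{n < L' : B n}`. -/
theorem card_filter_range_mul_of_periodic {L L' : ℕ} (hcop : Nat.Coprime L L')
    (A B : ℕ → Prop) [DecidablePred A] [DecidablePred B]
    (hA : ∀ n, A n ↔ A (n % L)) (hB : ∀ n, B n ↔ B (n % L')) :
    ((Finset.range (L * L')).filter (fun n => A n ∧ B n)).card =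
      ((Finset.range L).filter A).card * ((Finset.range L').filter B).card := by
  classical
  rcases Nat.eq_zero_or_pos L with hL | hL
  · subst hL
    have : L' = 1 := by simpa using hcop
    subst this
    simp
  rcases Nat.eq_zero_or_pos L' with hL' | hL'
  · subst hL'
    have : L = 1 := by simpa using hcop
    subst this
    simp
  set φ : ℕ → ℕ × ℕ := fun n => (n % L, n % L') with hφ
  have hinj : Set.InjOn φ (Finset.range (L * L') : Set ℕ) := by
    intro n hn m hm h
    simp only [Finset.coe_range, Set.mem_Iio] at hn hm
    simp only [hφ, Prod.mk.injEq] at h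
    have h1 : n ≡ m [MOD L] := h.1
    have h2 : n ≡ m [MOD L'] := h.2
    have h3 : n ≡ m [MOD L * L'] := (Nat.modEq_and_modEq_iff_modEq_mul hcop).mp ⟨h1, h2⟩
    exact Nat.ModEq.eq_of_lt_of_lt h3 hn hm
  have himage : (Finset.range (L * L')).image φ = Finset.range L ×ˢ Finset.range L' := by
    refine Finset.eq_of_subset_of_card_le (fun x hx => ?_) ?_
    · rw [Finset.mem_image] at hx
      obtain ⟨n, -, rfl⟩ := hx
      simp only [hφ, Finset.mem_product, Finset.mem_range]
      exact ⟨Nat.mod_lt n hL, Nat.mod_lt n hL'⟩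
    · rw [Finset.card_product, Finset.card_range, Finset.card_range,
        Finset.card_image_of_injOn hinj, Finset.card_range]
  calc ((Finset.range (L * L')).filter (fun n => A n ∧ B n)).card
      = ((Finset.range (L * L')).filter (fun n => A (φ n).1 ∧ B (φ n).2)).card := by
        congr 1; exact Finset.filter_congr fun n _ => by rw [hφ]; exact and_congr (hA n) (hB n)
    _ = (((Finset.range (L * L')).filter (fun n => A (φ n).1 ∧ B (φ n).2)).image φ).card :=
        (Finset.card_image_of_injOn (hinj.mono (Finset.coe_subset.mpr
          (Finset.filter_subset _ _)))).symm
    _ = (((Finset.range (L * L')).image φ).filter (fun x => A x.1 ∧ B x.2)).card := by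
        rw [Finset.filter_image]
    _ = ((Finset.range L).filter A).card * ((Finset.range L').filter B).card := by
        rw [himage, Finset.filter_product, Finset.card_product]

/-! ### Multiplicativity of `lcm` and `ρ` over tuples with coprime supports -/

/-- `tupleLcm (d * d') = tupleLcm d * tupleLcm d'`. -/
theorem tupleLcm_mul {d d' : Fin k → ℕ} (hcop : Nat.Coprime (∏ i, d i) (∏ i, d' i)) :
    tupleLcm (d * d') = tupleLcm d * tupleLcm d' := by
  have hc : Nat.Coprime (tupleLcm d) (tupleLcm d') :=
    Nat.Coprime.of_dvd (tupleLcm_dvd_prod d) (tupleLcm_dvd_prod d') hcop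
  refine Nat.dvd_antisymm (Finset.lcm_dvd fun i _ => ?_) (hc.mul_dvd_of_dvd_of_dvd ?_ ?_)
  · exact mul_dvd_mul (dvd_tupleLcm d i) (dvd_tupleLcm d' i)
  · exact Finset.lcm_dvd fun i _ => (Dvd.intro _ rfl).trans (dvd_tupleLcm (d * d') i)
  · exact Finset.lcm_dvd fun i _ =>
      (Dvd.intro_left _ rfl).trans (dvd_tupleLcm (d * d') i)

/-- For componentwise products of tuples with coprime supports the simultaneous condition splits. -/
theorem sysPred_mul_iff (f : Fin k → ℤ[X]) {d d' : Fin k → ℕ}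
    (hcop : Nat.Coprime (∏ i, d i) (∏ i, d' i)) (n : ℕ) :
    (∀ i, (((d * d') i : ℕ) : ℤ) ∣ (f i).eval (n : ℤ)) ↔
      (∀ i, ((d i : ℕ) : ℤ) ∣ (f i).eval (n : ℤ)) ∧ ∀ i, ((d' i : ℕ) : ℤ) ∣ (f i).eval (n : ℤ) := by
  have hci : ∀ i, Nat.Coprime (d i) (d' i) := fun i =>
    Nat.Coprime.of_dvd (Finset.dvd_prod_of_mem d (Finset.mem_univ i))
      (Finset.dvd_prod_of_mem d' (Finset.mem_univ i)) hcop
  simp only [Pi.mul_apply, Nat.cast_mul]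
  constructor
  · intro h
    exact ⟨fun i => (Dvd.intro _ rfl).trans (h i), fun i => (Dvd.intro_left _ rfl).trans (h i)⟩
  · rintro ⟨h1, h2⟩ i
    exact (Int.isCoprime_iff_gcd_eq_one.mpr (by
      rw [Int.gcd_natCast_natCast]; exact hci i)).mul_dvd (h1 i) (h2 i)

/-- **Multiplicativity of `ρ`**: `ρ(dd') = ρ(d) ρ(d')` for tuples with coprime supports (CRT). -/
theorem sysCount_mul (f : Fin k → ℤ[X]) {d d' : Fin k → ℕ}
    (hcop : Nat.Coprime (∏ i, d i) (∏ i, d' i)) :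
    sysCount f (d * d') = sysCount f d * sysCount f d' := by
  classical
  have hc : Nat.Coprime (tupleLcm d) (tupleLcm d') :=
    Nat.Coprime.of_dvd (tupleLcm_dvd_prod d) (tupleLcm_dvd_prod d') hcop
  unfold sysCount sysSols
  rw [tupleLcm_mul hcop]
  have h1 : ((Finset.range (tupleLcm d * tupleLcm d')).filter
      (fun n : ℕ => ∀ i, (((d * d') i : ℕ) : ℤ) ∣ (f i).eval (n : ℤ))).card =
      ((Finset.range (tupleLcm d * tupleLcm d')).filter
        (fun n : ℕ => (∀ i, ((d i : ℕ) : ℤ) ∣ (f i).eval (n : ℤ)) ∧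
          ∀ i, ((d' i : ℕ) : ℤ) ∣ (f i).eval (n : ℤ))).card := by
    congr 1; exact Finset.filter_congr fun n _ => sysPred_mul_iff f hcop n
  rw [h1, card_filter_range_mul_of_periodic hc _ _ (sysPred_mod f d) (sysPred_mod f d')]

/-! ### Members of a Bateman–Horn system -/

section Members

open Literature.NumberTheory.Sieve

variable (f : Fin k → ℤ[X])

/-- The members of a Bateman–Horn system: each `ρ_{f_i}(p) ≤ ω_f(p) < p`. -/
theorem rootCount_member_lt (hsys : IsBatemanHornSystem f) (i : Fin k) {p : ℕ} (hp : p.Prime) :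
    polyRootCountMod ![f i] p < p := by
  refine lt_of_le_of_lt ?_ (hsys.hasNoFixedPrimeDivisor p hp)
  rw [polyRootCountMod_single]
  unfold polyRootCountMod
  refine Finset.card_le_card fun n hn => ?_
  rw [Finset.mem_filter] at hn ⊢
  exact ⟨hn.1, hn.2.trans (Finset.dvd_prod_of_mem _ (Finset.mem_univ i))⟩

/-- Members of a Bateman–Horn system have positive degree (a constant member `c > 1` would have
a prime factor `q` with `ω_f(q) = q`). -/
theorem natDegree_member_pos (hsys : IsBatemanHornSystem f) (i : Fin k) : 1 ≤ (f i).natDegree := by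
  by_contra h
  push Not at h
  have h0 : (f i).natDegree = 0 := by omega
  set c : ℤ := (f i).coeff 0 with hcdef
  have hc : f i = Polynomial.C c := Polynomial.eq_C_of_natDegree_eq_zero h0
  have hlc : (f i).leadingCoeff = c := by rw [Polynomial.leadingCoeff, h0]
  have hcpos : 0 < c := hlc ▸ hsys.leadingCoeff_pos i
  have hc1 : c ≠ 1 := by
    intro h1
    have hirr := hsys.irreducible i
    rw [hc, h1, map_one] at hirr
    exact hirr.not_isUnit isUnit_one
  have hc2 : 2 ≤ c.natAbs := by omega
  set q : ℕ := c.natAbs.minFac with hq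
  have hqp : q.Prime := Nat.minFac_prime (by omega)
  have hqc : (q : ℤ) ∣ c := Int.natCast_dvd.mpr (Nat.minFac_dvd _)
  have hcount : polyRootCountMod f q = q := by
    unfold polyRootCountMod
    rw [Finset.filter_true_of_mem fun n _ => ?_, Finset.card_range]
    refine hqc.trans ?_
    have : (f i).eval (n : ℤ) = c := by rw [hc, Polynomial.eval_C]
    rw [← this]
    exact Finset.dvd_prod_of_mem _ (Finset.mem_univ i)
  have := hsys.hasNoFixedPrimeDivisor q hqp
  rw [hcount] at this
  exact lt_irrefl _ this

end Members

end Summit.Parity.BatemanHorn.Theorems.TypeIMainTerm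

end
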